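import Mathlib
import Summits.Ventures.PercRepro2.TypedPendantRoot
import Summits.Ventures.PercRepro2.TypedPendantA3
import Summits.Ventures.PercRepro2.TypedPendantPair
import Summits.Ventures.PercRepro2.TypedCaterpillarA

/-!
# The Y-configuration of the equality locus of (PM-ROOT), family B: `(o·b) — u — x — a₂`,
`x — a₃`, root at `u` (blind cell PercRepro2, mine-2 g52, 2026-08-29; `conjectures/MINE-2.md`
M2-109)

The mirror of `TypedCaterpillarA.lean`: the pair `o = b` is the class-`1` pendant of `u` and `a₃`
the class-`1` pendant of `x`.  The same peel chain (pair, `a₂`, `a₃`, root — the kernels `KC2`,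
`KC3`, `KC4` of family A) leaves the single typed edge `u–x`, whose closed base state is now
`a₁ ~ (o·b)` against `a₂ ~ a₃` (`cat_stB`, `catClosedB`); **`caterpillarB_corner`**: `N₁ = N₃`,
`N₂ = 2·N₃`, `N₃ = 2·C(2, c)` for the class `c ∈ {1, 2}` of `u–x` — the same values
`(4, 8, 4)` / `(2, 4, 2)` as family A, by `decide`.  Own work; standard axioms.
-/

namespace Summit.Ventures.PercRepro2

namespace CovForm

namespace TypedRed

open OneTyped TypedA3

/-! ## The base state of family B -/

section CaterpillarStatesB

open Classical

variable {V : Type*} {E : Type*} [DecidableEq E]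
variable (ends : E → Sym2 V) (a₁ a₂ a₃ u x w : V)

/-- The state of a copy of the family-B caterpillar with `u–x` closed and the four pendant edges
open: `a₁ ~ (o·b)`, `a₂ ~ a₃`, nothing across. -/
def catClosedB : St := (false, true, false, true, false, false, true)

/-- A configuration of the family-B caterpillar with the four pendant edges open, `u–x` in state
`p`, and every other edge at `u` and at `x` closed: the connections among the marks. -/
lemma cat_stB {f e₃ ex g₂ gp : E} (hf : ends f = s(a₁, u)) (he₃ : ends e₃ = s(a₃, x))
    (hex : ends ex = s(u, x)) (hg₂ : ends g₂ = s(a₂, x)) (hgp : ends gp = s(w, u))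
    (hleaf1 : ∀ e, a₁ ∈ ends e → e = f) (hleafw : ∀ e, w ∈ ends e → e = gp)
    (h1u : a₁ ≠ u) (h2u : a₂ ≠ u) (h12 : a₁ ≠ a₂) (h13 : a₁ ≠ a₃) (h3u : a₃ ≠ u)
    (hwu : w ≠ u) (hw1 : w ≠ a₁) (hw2 : w ≠ a₂) (hw3 : w ≠ a₃)
    (ω : Config E) (hωf : ω f = true) (hωe₃ : ω e₃ = true) (hωg₂ : ω g₂ = true)
    (hωgp : ω gp = true) (hclu : ∀ e, e ≠ f → e ≠ gp → e ≠ ex → u ∈ ends e → ω e = false)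
    (p : Bool) (hωex : ω ex = p) :
    st ends w a₁ a₂ a₃ w ω = cond p catOpen catClosedB := by
  have c1u : Conn ends ω a₁ u := conn_of_openAdj ⟨f, hωf, hf⟩
  have cwu : Conn ends ω w u := conn_of_openAdj ⟨gp, hωgp, hgp⟩
  have c2x : Conn ends ω a₂ x := conn_of_openAdj ⟨g₂, hωg₂, hg₂⟩
  have c3x : Conn ends ω a₃ x := conn_of_openAdj ⟨e₃, hωe₃, he₃⟩
  have c1w : Conn ends ω a₁ w := conn_trans c1u (conn_symm cwu)
  have c23 : Conn ends ω a₂ a₃ := conn_trans c2x (conn_symm c3x)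
  cases p
  · -- `u–x` closed: `{a₁, u, w}` is closed under open adjacency
    have hS : ∀ p ∈ ({a₁, u, w} : Set V), ∀ q, (openGraph ends ω).Adj p q →
        q ∈ ({a₁, u, w} : Set V) := by
      intro p hp q hpq
      rw [openGraph_adj] at hpq
      obtain ⟨-, e, he, hends⟩ := hpq
      simp only [Set.mem_insert_iff, Set.mem_singleton_iff] at hp ⊢
      rcases hp with rfl | rfl | rfl
      · have hef : e = f := hleaf1 e (by rw [hends]; exact Sym2.mem_mk_left _ _)
        subst hef
        rw [hf, Sym2.eq_iff] at hends
        rcases hends with ⟨-, h⟩ | ⟨h, -⟩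
        · exact Or.inr (Or.inl h.symm)
        · exact Or.inl h.symm
      · by_cases hef : e = f
        · subst hef
          rw [hf, Sym2.eq_iff] at hends
          rcases hends with ⟨h, -⟩ | ⟨h, -⟩
          · exact absurd h h1u
          · exact Or.inl h.symm
        · by_cases hegp : e = gp
          · subst hegp
            rw [hgp, Sym2.eq_iff] at hends
            rcases hends with ⟨h, -⟩ | ⟨h, -⟩
            · exact absurd h hwu
            · exact Or.inr (Or.inr h.symm)
          · by_cases heex : e = ex
            · subst heex
              rw [hωex] at he
              exact absurd he Bool.false_ne_true
            · have := hclu e hef hegp heex (by rw [hends]; exact Sym2.mem_mk_left _ _)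
              rw [this] at he
              exact absurd he Bool.false_ne_true
      · have hegp : e = gp := hleafw e (by rw [hends]; exact Sym2.mem_mk_left _ _)
        subst hegp
        rw [hgp, Sym2.eq_iff] at hends
        rcases hends with ⟨-, h⟩ | ⟨h, -⟩
        · exact Or.inr (Or.inl h.symm)
        · exact Or.inr (Or.inr h.symm)
    have hmem : ∀ v, Conn ends ω a₁ v → v ∈ ({a₁, u, w} : Set V) :=
      fun v hv => mem_of_conn_of_closed hS (by simp) hv
    have hmemw : ∀ v, Conn ends ω w v → v ∈ ({a₁, u, w} : Set V) :=
      fun v hv => mem_of_conn_of_closed hS (by simp) hv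
    have n21 : ¬ Conn ends ω a₂ a₁ := fun h => by
      have := hmem a₂ (conn_symm h)
      simp only [Set.mem_insert_iff, Set.mem_singleton_iff] at this
      rcases this with h | h | h
      · exact h12 h.symm
      · exact h2u h
      · exact hw2 h.symm
    have n2w : ¬ Conn ends ω a₂ w := fun h => by
      have := hmemw a₂ (conn_symm h)
      simp only [Set.mem_insert_iff, Set.mem_singleton_iff] at this
      rcases this with h | h | h
      · exact h12 h.symm
      · exact h2u h
      · exact hw2 h.symm
    have n13 : ¬ Conn ends ω a₁ a₃ := fun h => by
      have := hmem a₃ h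
      simp only [Set.mem_insert_iff, Set.mem_singleton_iff] at this
      rcases this with h | h | h
      · exact h13 h.symm
      · exact h3u h
      · exact hw3 h.symm
    unfold st catClosedB
    simp only [cond_false, Prod.mk.injEq]
    exact ⟨decide_eq_false n21, decide_eq_true c1w, decide_eq_false n2w, decide_eq_true c1w,
      decide_eq_false n2w, decide_eq_false n13, decide_eq_true c23⟩
  · -- `u–x` open: everything is connected
    have cux : Conn ends ω u x := conn_of_openAdj ⟨ex, hωex, hex⟩
    have c1x : Conn ends ω a₁ x := conn_trans c1u cux
    have c21 : Conn ends ω a₂ a₁ := conn_trans c2x (conn_symm c1x)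
    have c2w : Conn ends ω a₂ w := conn_trans c21 c1w
    have c13 : Conn ends ω a₁ a₃ := conn_trans c1x (conn_symm c3x)
    unfold st catOpen
    simp only [cond_true, Prod.mk.injEq]
    exact ⟨decide_eq_true c21, decide_eq_true c1w, decide_eq_true c2w, decide_eq_true c1w,
      decide_eq_true c2w, decide_eq_true c13, decide_eq_true c23⟩

end CaterpillarStatesB

/-! ## The peel chain and the corner (family B) -/

section CaterpillarB

open Classical

variable {V : Type*} {E : Type*} [Fintype E] [DecidableEq E] {R : Type*} [Field R]
variable (ends : E → Sym2 V) (a₁ a₂ a₃ u x w : V)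

/-- The value of a peeled kernel on the family-B caterpillar: the `Bool³`-sum over the placements
of `u–x` (class `c`) of the kernel on the two base states. -/
def catValB (K : St → St → St → ℤ) (c : ℕ) : ℤ :=
  ∑ p : Bool, ∑ q : Bool, ∑ r : Bool,
    if p.toNat + q.toNat + r.toNat = c then
      K (cond p catOpen catClosedB) (cond q catOpen catClosedB) (cond r catOpen catClosedB) else 0

/-- **The family-B caterpillar count**: on `(o·b) —1— u —c— x —1— a₂`, `x —1— a₃` with the root
`a₁` at `u` by the edge `f` of class `k ∈ {1, 2, 3}`, `u` and `x` carrying no other open edge, the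
typed count of `K₃` is `catValB (KC4 k) c`. -/
theorem caterpillarB_count {f e₃ ex g₂ gp : E} (hf : ends f = s(a₁, u)) (he₃ : ends e₃ = s(a₃, x))
    (hex : ends ex = s(u, x)) (hg₂ : ends g₂ = s(a₂, x)) (hgp : ends gp = s(w, u))
    (hleaf1 : ∀ e, a₁ ∈ ends e → e = f) (hleaf3 : ∀ e, a₃ ∈ ends e → e = e₃)
    (hleaf2 : ∀ e, a₂ ∈ ends e → e = g₂) (hleafw : ∀ e, w ∈ ends e → e = gp)
    (h1u : a₁ ≠ u) (h12 : a₁ ≠ a₂) (h13 : a₁ ≠ a₃) (h1w : a₁ ≠ w) (h2u : a₂ ≠ u) (h2x : a₂ ≠ x)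
    (h23 : a₂ ≠ a₃) (h2w : a₂ ≠ w) (h3u : a₃ ≠ u) (h3x : a₃ ≠ x) (h3w : a₃ ≠ w) (hwu : w ≠ u)
    (hux : u ≠ x)
    (hfe₃ : f ≠ e₃) (hfex : f ≠ ex) (hfg₂ : f ≠ g₂) (hfgp : f ≠ gp) (he₃ex : e₃ ≠ ex)
    (he₃g₂ : e₃ ≠ g₂) (he₃gp : e₃ ≠ gp) (hexg₂ : ex ≠ g₂) (hexgp : ex ≠ gp) (hg₂gp : g₂ ≠ gp)
    (F : Finset E) (hF : ∀ e ∈ F, e = f ∨ e = e₃ ∨ e = ex ∨ e = g₂ ∨ e = gp) (hfF : f ∈ F)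
    (he₃F : e₃ ∈ F) (hexF : ex ∈ F) (hg₂F : g₂ ∈ F) (hgpF : gp ∈ F) (z : Config E)
    (hclu : ∀ e, e ≠ f → e ≠ gp → e ≠ ex → u ∈ ends e → z e = false)
    (τ : E → ℕ) (hτ3 : τ e₃ = 1) (hτ2 : τ g₂ = 1) (hτp : τ gp = 1) (k : ℕ)
    (hk : k = 1 ∨ k = 2 ∨ k = 3) :
    typedCount F z (Function.update τ f k)
        (K3 ends w a₁ a₂ a₃ w : Config E → Config E → Config E → R) =
      ((catValB (KC4 k) (τ ex) : ℤ) : R) := by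
  set τ' := Function.update τ f k with hτ'
  set S := st ends w a₁ a₂ a₃ w with hS
  have hτ'p : τ' gp = 1 := by rw [hτ', Function.update_of_ne hfgp.symm]; exact hτp
  have hτ'2 : τ' g₂ = 1 := by rw [hτ', Function.update_of_ne hfg₂.symm]; exact hτ2
  have hτ'3 : τ' e₃ = 1 := by rw [hτ', Function.update_of_ne hfe₃.symm]; exact hτ3
  have hτ'f : τ' f = k := by rw [hτ', Function.update_self]
  have hτ'x : τ' ex = τ ex := by rw [hτ', Function.update_of_ne hfex.symm]
  have hst2 : ∀ (x : Config E) (p : Bool), S (Function.update x g₂ p) =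
      cond p (S (Function.update x g₂ true)) (killA2 (S (Function.update x g₂ true))) := by
    intro x p
    cases p
    · exact st_update_pendant_a2 ends w a₁ a₂ a₃ w hg₂ hleaf2 h2x h2w h12.symm h23 h2w x
    · rfl
  have hst3 : ∀ (x : Config E) (p : Bool), S (Function.update x e₃ p) =
      cond p (S (Function.update x e₃ true)) (kill3 (S (Function.update x e₃ true))) := by
    intro x p
    cases p
    · exact st_update_pendant_a3 ends w a₁ a₂ a₃ w he₃ hleaf3 h3x h3w h13.symm h23.symm h3w x
    · rfl
  have hst1 : ∀ (x : Config E) (p : Bool), S (Function.update x f p) =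
      cond p (S (Function.update x f true)) (killA1 (S (Function.update x f true))) := by
    intro x p
    cases p
    · exact st_update_pendant_a1 ends w a₁ a₂ a₃ w hf hleaf1 h1u h1w h12 h13 h1w x
    · rfl
  -- step 1: the pair (at `u`)
  rw [typedCount_pendant_pair_one ends a₁ a₂ a₃ w hgp hleafw hwu h1w.symm h2w.symm h3w.symm F hgpF
    z τ' hτ'p]
  -- step 2: the pendant `a₂`
  rw [typedCount_peel_one KP killA2 S hst2 (F.erase gp)
    (Finset.mem_erase.2 ⟨hg₂gp, hg₂F⟩) _ τ' hτ'2]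
  have e2 : (fun x y w' => ((KP (S x) (killA2 (S y)) (killA2 (S w')) +
      KP (killA2 (S x)) (S y) (killA2 (S w')) + KP (killA2 (S x)) (killA2 (S y)) (S w') : ℤ) : R)) =
      fun x y w' => ((KC2 (S x) (S y) (S w') : ℤ) : R) := rfl
  rw [e2]
  -- step 3: the pendant `a₃`
  rw [typedCount_peel_one KC2 kill3 S hst3 ((F.erase gp).erase g₂)
    (Finset.mem_erase.2 ⟨he₃g₂, Finset.mem_erase.2 ⟨he₃gp, he₃F⟩⟩) _ τ' hτ'3]
  have e3 : (fun x y w' => ((KC2 (S x) (kill3 (S y)) (kill3 (S w')) +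
      KC2 (kill3 (S x)) (S y) (kill3 (S w')) + KC2 (kill3 (S x)) (kill3 (S y)) (S w') : ℤ) : R)) =
      fun x y w' => ((KC3 (S x) (S y) (S w') : ℤ) : R) := rfl
  rw [e3]
  have hfF3 : f ∈ ((F.erase gp).erase g₂).erase e₃ :=
    Finset.mem_erase.2 ⟨hfe₃, Finset.mem_erase.2 ⟨hfg₂, Finset.mem_erase.2 ⟨hfgp, hfF⟩⟩⟩
  have hF4 : (((F.erase gp).erase g₂).erase e₃).erase f = {ex} := by
    ext e
    simp only [Finset.mem_erase, Finset.mem_singleton]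
    constructor
    · rintro ⟨hef, hee₃, heg₂, hegp, heF⟩
      rcases hF e heF with h | h | h | h | h
      · exact absurd h hef
      · exact absurd h hee₃
      · exact h
      · exact absurd h heg₂
      · exact absurd h hegp
    · rintro rfl
      exact ⟨hfex.symm, he₃ex.symm, hexg₂, hexgp, hexF⟩
  set z₄ : Config E := Function.update (Function.update (Function.update (Function.update z gp true)
    g₂ true) e₃ true) f true with hz₄
  have hst4 : ∀ p : Bool, S (Function.update (Function.update z₄ ex false) ex p) =
      cond p catOpen catClosedB := by
    intro p
    rw [Function.update_idem, hS]
    refine cat_stB ends a₁ a₂ a₃ u x w hf he₃ hex hg₂ hgp hleaf1 hleafw h1u h2u h12 h13 h3u hwu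
      h1w.symm h2w.symm h3w.symm _ ?_ ?_ ?_ ?_ ?_ p (Function.update_self ex p z₄)
    · rw [Function.update_of_ne hfex, hz₄, Function.update_self]
    · rw [Function.update_of_ne he₃ex, hz₄, Function.update_of_ne hfe₃.symm, Function.update_self]
    · rw [Function.update_of_ne hexg₂.symm, hz₄, Function.update_of_ne hfg₂.symm,
        Function.update_of_ne he₃g₂.symm, Function.update_self]
    · rw [Function.update_of_ne hexgp.symm, hz₄, Function.update_of_ne hfgp.symm,
        Function.update_of_ne he₃gp.symm, Function.update_of_ne hg₂gp.symm, Function.update_self]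
    · intro e hef hegp heex hue
      by_cases heg₂ : e = g₂
      · subst heg₂
        rw [hg₂, Sym2.mem_iff] at hue
        rcases hue with h | h
        · exact absurd h.symm h2u
        · exact absurd h hux
      · by_cases hee₃ : e = e₃
        · subst hee₃
          rw [he₃, Sym2.mem_iff] at hue
          rcases hue with h | h
          · exact absurd h.symm h3u
          · exact absurd h hux
        · rw [Function.update_of_ne heex, hz₄, Function.update_of_ne hef, Function.update_of_ne hee₃,
            Function.update_of_ne heg₂, Function.update_of_ne hegp]
          exact hclu e hef hegp heex hue
  have final : ∀ K : St → St → St → ℤ,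
      typedCount ({ex} : Finset E) z₄ τ' (fun x y w' => ((K (S x) (S y) (S w') : ℤ) : R)) =
        ((catValB K (τ ex) : ℤ) : R) := by
    intro K
    rw [typedCount_split {ex} ex (Finset.mem_singleton_self ex), Finset.erase_singleton, hτ'x]
    simp only [typedCount_empty, hst4]
    unfold catValB
    push_cast
    rfl
  rcases hk with rfl | rfl | rfl
  · rw [typedCount_peel_one KC3 killA1 S hst1 _ hfF3 _ τ' hτ'f, hF4]
    have e4 : (fun x y w' => ((KC3 (S x) (killA1 (S y)) (killA1 (S w')) +
        KC3 (killA1 (S x)) (S y) (killA1 (S w')) + KC3 (killA1 (S x)) (killA1 (S y)) (S w') : ℤ) : R)) =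
        fun x y w' => ((KC4one (S x) (S y) (S w') : ℤ) : R) := rfl
    rw [e4, final KC4one]
    rfl
  · rw [typedCount_peel_two KC3 killA1 S hst1 _ hfF3 _ τ' hτ'f, hF4]
    have e4 : (fun x y w' => ((KC3 (killA1 (S x)) (S y) (S w') +
        KC3 (S x) (killA1 (S y)) (S w') + KC3 (S x) (S y) (killA1 (S w')) : ℤ) : R)) =
        fun x y w' => ((KC4two (S x) (S y) (S w') : ℤ) : R) := rfl
    rw [e4, final KC4two]
    rfl
  · rw [typedCount_peel_three KC3 killA1 S hst1 _ hfF3 _ τ' hτ'f, hF4, final KC3]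
    rfl

/-- `u–x` of class `1`, root of class `1`. -/
lemma catValB_one_one : catValB (KC4 1) 1 = 4 := by decide
/-- `u–x` of class `1`, root of class `2`. -/
lemma catValB_two_one : catValB (KC4 2) 1 = 8 := by decide
/-- `u–x` of class `1`, root of class `3`. -/
lemma catValB_three_one : catValB (KC4 3) 1 = 4 := by decide
/-- `u–x` of class `2`, root of class `1`. -/
lemma catValB_one_two : catValB (KC4 1) 2 = 2 := by decide
/-- `u–x` of class `2`, root of class `2`. -/
lemma catValB_two_two : catValB (KC4 2) 2 = 4 := by decide
/-- `u–x` of class `2`, root of class `3`. -/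
lemma catValB_three_two : catValB (KC4 3) 2 = 2 := by decide

/-- **The caterpillar corner (family B)**: on `(o·b) —1— u —c— x —1— a₂`, `x —1— a₃` with the root
`a₁` pendant at `u` and `c ∈ {1, 2}`: `N₁ = N₃`, `N₂ = 2·N₃`, `N₃ = 2·C(2, c)`. -/
theorem caterpillarB_corner {f e₃ ex g₂ gp : E} (hf : ends f = s(a₁, u))
    (he₃ : ends e₃ = s(a₃, x)) (hex : ends ex = s(u, x)) (hg₂ : ends g₂ = s(a₂, x))
    (hgp : ends gp = s(w, u))
    (hleaf1 : ∀ e, a₁ ∈ ends e → e = f) (hleaf3 : ∀ e, a₃ ∈ ends e → e = e₃)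
    (hleaf2 : ∀ e, a₂ ∈ ends e → e = g₂) (hleafw : ∀ e, w ∈ ends e → e = gp)
    (h1u : a₁ ≠ u) (h12 : a₁ ≠ a₂) (h13 : a₁ ≠ a₃) (h1w : a₁ ≠ w) (h2u : a₂ ≠ u) (h2x : a₂ ≠ x)
    (h23 : a₂ ≠ a₃) (h2w : a₂ ≠ w) (h3u : a₃ ≠ u) (h3x : a₃ ≠ x) (h3w : a₃ ≠ w) (hwu : w ≠ u)
    (hux : u ≠ x)
    (hfe₃ : f ≠ e₃) (hfex : f ≠ ex) (hfg₂ : f ≠ g₂) (hfgp : f ≠ gp) (he₃ex : e₃ ≠ ex)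
    (he₃g₂ : e₃ ≠ g₂) (he₃gp : e₃ ≠ gp) (hexg₂ : ex ≠ g₂) (hexgp : ex ≠ gp) (hg₂gp : g₂ ≠ gp)
    (F : Finset E) (hF : ∀ e ∈ F, e = f ∨ e = e₃ ∨ e = ex ∨ e = g₂ ∨ e = gp) (hfF : f ∈ F)
    (he₃F : e₃ ∈ F) (hexF : ex ∈ F) (hg₂F : g₂ ∈ F) (hgpF : gp ∈ F) (z : Config E)
    (hclu : ∀ e, e ≠ f → e ≠ gp → e ≠ ex → u ∈ ends e → z e = false)
    (τ : E → ℕ) (hτ3 : τ e₃ = 1) (hτ2 : τ g₂ = 1) (hτp : τ gp = 1) (hτx : τ ex = 1 ∨ τ ex = 2) :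
    typedCount F z (Function.update τ f 1)
          (K3 ends w a₁ a₂ a₃ w : Config E → Config E → Config E → R) =
        typedCount F z (Function.update τ f 3) (K3 ends w a₁ a₂ a₃ w) ∧
      typedCount F z (Function.update τ f 2)
          (K3 ends w a₁ a₂ a₃ w : Config E → Config E → Config E → R) =
        2 * typedCount F z (Function.update τ f 3) (K3 ends w a₁ a₂ a₃ w) ∧
      typedCount F z (Function.update τ f 3)
          (K3 ends w a₁ a₂ a₃ w : Config E → Config E → Config E → R) =
        2 * (Nat.choose 2 (τ ex) : R) := by
  have h1 := caterpillarB_count (R := R) ends a₁ a₂ a₃ u x w hf he₃ hex hg₂ hgp hleaf1 hleaf3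
    hleaf2 hleafw h1u h12 h13 h1w h2u h2x h23 h2w h3u h3x h3w hwu hux hfe₃ hfex hfg₂ hfgp he₃ex
    he₃g₂ he₃gp hexg₂ hexgp hg₂gp F hF hfF he₃F hexF hg₂F hgpF z hclu τ hτ3 hτ2 hτp 1
    (Or.inl rfl)
  have h2 := caterpillarB_count (R := R) ends a₁ a₂ a₃ u x w hf he₃ hex hg₂ hgp hleaf1 hleaf3
    hleaf2 hleafw h1u h12 h13 h1w h2u h2x h23 h2w h3u h3x h3w hwu hux hfe₃ hfex hfg₂ hfgp he₃ex
    he₃g₂ he₃gp hexg₂ hexgp hg₂gp F hF hfF he₃F hexF hg₂F hgpF z hclu τ hτ3 hτ2 hτp 2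
    (Or.inr (Or.inl rfl))
  have h3 := caterpillarB_count (R := R) ends a₁ a₂ a₃ u x w hf he₃ hex hg₂ hgp hleaf1 hleaf3
    hleaf2 hleafw h1u h12 h13 h1w h2u h2x h23 h2w h3u h3x h3w hwu hux hfe₃ hfex hfg₂ hfgp he₃ex
    he₃g₂ he₃gp hexg₂ hexgp hg₂gp F hF hfF he₃F hexF hg₂F hgpF z hclu τ hτ3 hτ2 hτp 3
    (Or.inr (Or.inr rfl))
  rw [h1, h2, h3]
  rcases hτx with hc | hc
  · rw [hc, catValB_one_one, catValB_two_one, catValB_three_one]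
    norm_num
  · rw [hc, catValB_one_two, catValB_two_two, catValB_three_two]
    norm_num

end CaterpillarB

end TypedRed

end CovForm

end Summit.Ventures.PercRepro2
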